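import Summits.QuantumFields.GaugeBoot.SOMasterLoopRestProducts
import HarnessLib

/-!
# The integrated one-link identity for `SO(N)` at a marked location, summed over `𝔰𝔬(N)` (gauge-boot, ADDENDUM 27 part M5b)

HONEST FRAMING (cell `pub-gaugeboot`, page 1 of every file): the venture produces certified bounds
on lattice expectations at stated coupling, gauge group, dimension and torus size; NOT a mass gap,
NOT a continuum limit, NOT a string tension; NOT Yang–Mills-summit-bearing (barriers
`FixedCouplingUltralocality`, `PerturbativeInvisibility`).  An exact integration-by-parts identity for the
free-boundary `SO(N)` lattice gauge measure; nothing about the large-`N` limit is claimed here.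

## Content

Ninth file of the lane's programme on the tree's NAMED FACT `Chatterjee2019LargeN.UnsymmetrizedMasterLoopEquation`
(Chatterjee, CMP 366 (2019), Theorem 8.1).  For the free-boundary Wilson measure `μ = zdWilsonMeasure (soRep N) β' Λ`,
a link `ε` all of whose plaquettes lie in `Λ`, a word `l` with a location `x`, spectators `rest`, and the direction
`X = X_ij`, the one-link Schwinger–Dyson identity (part M0) applied to the test function
`f = tr(insProd_x(l)) · Π_r W_{l_r}` along the one-parameter subgroup `t ↦ exp(t X_ij)` of `SO(N)` (part M2) reads

  `∫ [(Σ_y tr ins2Prod_{x,y}) · Π W + tr(insProd_x) · (Π W)'] dμ = β' ∫ tr(insProd_x) · Π W · S'_ij dμ`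

(★ `integral_pair_identity`), with `S'_ij = actionDeriv'` (part M5a).  By uniqueness of derivatives the complex
insertion traces of the plaquette words are the complexified real ones (`ofReal_re_sum_trace_insProd`), so that
`S'_ij` is, in `ℂ`, `−Σ_{p ∋ ε} Σ_z tr(insProd_z(∂p))` (`ofReal_actionDeriv'`).  Summing over all `(i, j)` and all
locations `x` of `l` (★ `integral_sum_identity`) is the raw form of Theorem 8.1, before the contractions of part M4c
are inserted (part M5c/d).

Everything is `[folklore]`.
-/

noncomputable section

open NormedSpace MeasureTheory
open scoped Matrix.Norms.Frobenius Matrix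
open Literature.Probability.LatticeModels (Site)
open Literature.MathematicalPhysics.QuantumLattice (LGConfig ZdEdge ZdPlaquette plaquettesTouching plaquetteEdges
  IsCylinder wilsonBoundaryAction)
open Literature.MathematicalPhysics.QuantumFieldTheory (Chatterjee2019LargeN.Word zdWilsonMeasure plaquettesIn
  isProbabilityMeasure_zdWilsonMeasure)
open Literature.MathematicalPhysics.QuantumFieldTheory.Chatterjee2019LargeN
  (SO soRep soRep_apply DEdge LoopSeq plaquetteWord)

namespace Summit.QuantumFields.GaugeBoot

namespace SOMasterLoop

variable {d N : ℕ}

/-! ## The one-parameter data of the direction `X_ij` -/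

section OneParam

/-- The complexified antisymmetric unit is the antisymmetric unit over `ℂ`. [folklore] -/
theorem map_soDir_ofReal (i j : Fin N) :
    ((soDir i j : Matrix (Fin N) (Fin N) ℝ)).map (Complex.ofRealHom : ℝ →+* ℂ) = (soDir i j : Matrix (Fin N) (Fin N) ℂ) := by
  ext a b
  simp only [Matrix.map_apply, soDir_apply]
  split_ifs <;> simp

/-- The one-parameter subgroup of `SO(N)` generated by `X_ij`. [folklore] -/
def soFlow (i j : Fin N) : ℝ → SO N := soOneParam (soDir i j) (transpose_soDir i j)

/-- It is multiplicative (hypothesis `hk`). [folklore] -/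
theorem soFlow_add (i j : Fin N) (s t : ℝ) : soFlow i j (s + t) = soFlow i j s * soFlow i j t :=
  soOneParam_add _ s t

/-- Read through `soRep` it is `exp(t X_ij)` (hypothesis `hX`). [folklore] -/
theorem soRep_soFlow (i j : Fin N) (t : ℝ) : soRep N (soFlow i j t) = exp ((t : ℂ) • (soDir i j : Matrix (Fin N) (Fin N) ℂ)) := by
  rw [soFlow, soRep_soOneParam, map_soDir_ofReal]

end OneParam

/-! ## Reality of the insertion traces, via uniqueness of derivatives -/

section Reality

variable (ε : ZdEdge d) (i j : Fin N)

/-- **The insertion-trace sum of a word is real**: the complexified real derivative of `W_w` and the complex derivative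
of `(W_w : ℂ)` along the same flow coincide (`HasDerivAt.unique`). [folklore] -/
theorem ofReal_re_sum_trace_insProd (U : LGConfig d (SO N)) (w : Chatterjee2019LargeN.Word d) :
    (((∑ z : Fin w.length, (insProd ε (soDir i j) w z U).trace).re : ℝ) : ℂ) =
      ∑ z : Fin w.length, (insProd ε (soDir i j) w z U).trace := by
  set D : ℂ := ∑ z : Fin w.length, (insProd ε (soDir i j) w z U).trace with hD
  have h1 : HasDerivAt (fun t : ℝ => (holC (Function.update U ε (soFlow i j t * U ε)) w).trace) D 0 :=
    hasDerivAt_trace_holC ε _ (soFlow_add i j) (soRep_soFlow i j) U w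
  have h2 : HasDerivAt (fun t : ℝ => ((holC (Function.update U ε (soFlow i j t * U ε)) w).trace).re) D.re 0 := by
    simpa [Function.comp_def] using (Complex.reCLM.hasFDerivAt.comp_hasDerivAt (0 : ℝ) h1)
  have h3 : HasDerivAt (fun t : ℝ => (((holC (Function.update U ε (soFlow i j t * U ε)) w).trace.re : ℝ) : ℂ))
      ((D.re : ℝ) : ℂ) 0 := h2.ofReal_comp
  have h4 : (fun t : ℝ => (((holC (Function.update U ε (soFlow i j t * U ε)) w).trace.re : ℝ) : ℂ)) =
      fun t : ℝ => (holC (Function.update U ε (soFlow i j t * U ε)) w).trace := by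
    funext t
    rw [trace_holC, Complex.ofReal_re]
  rw [h4] at h3
  exact h3.unique h1

/-- Hence the action derivative in `ℂ`: `(S'_ij : ℂ) = −Σ_{p ∋ ε} Σ_z tr(insProd_z(∂p))`. [folklore] -/
theorem ofReal_actionDeriv' (U : LGConfig d (SO N)) :
    ((actionDeriv' ε (soDir i j : Matrix (Fin N) (Fin N) ℂ) U : ℝ) : ℂ) =
      -∑ p ∈ plaquettesTouching ({ε} : Finset (ZdEdge d)),
        ∑ z : Fin (plaquetteWord p).length, (insProd ε (soDir i j) (plaquetteWord p) z U).trace := by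
  rw [actionDeriv', Complex.ofReal_neg, Complex.ofReal_sum]
  simp only [ofReal_re_sum_trace_insProd]

end Reality

/-! ## The integrated identity at one location and one direction -/

section Identity

variable (β' : ℝ) (Λ : Finset (Site d)) (ε : ZdEdge d)
  (hl : ∀ p ∈ plaquettesTouching ({ε} : Finset (ZdEdge d)),
    ((p.1, p.2.1.1, p.2.1.2) : Site d × Fin d × Fin d) ∈ plaquettesIn Λ)

/-- `SO(N)` is second countable (through the faithful `soRep`). [folklore] -/
theorem secondCountable_SO : SecondCountableTopology (SO N) :=
  ((soLatticeRep N).continuous.isClosedEmbedding (soLatticeRep N).injective).isEmbedding.secondCountableTopology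

/-- The free Wilson measure of `SO(N)` is a probability measure. [folklore] -/
theorem isProbabilityMeasure_soWilson : IsProbabilityMeasure (zdWilsonMeasure (d := d) (soRep N) β' Λ) := by
  haveI := secondCountable_SO (N := N)
  exact isProbabilityMeasure_zdWilsonMeasure (soRep N) (soLatticeRep N).continuous β' Λ

include hl in
/-- ★ **The integrated one-link identity at the location `x` in the direction `X_ij`**:
`∫ [(Σ_y tr ins2Prod_{x,y}) Π W + tr(insProd_x) (Π W)'] dμ = β' ∫ tr(insProd_x) Π W S'_ij dμ`. [folklore] -/
theorem integral_pair_identity (l : Chatterjee2019LargeN.Word d) (rest : LoopSeq d) (x : Fin l.length) (i j : Fin N) :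
    ∫ U, ((∑ y : Fin l.length, (ins2Prod ε (soDir i j) l x y U).trace) * prodW rest U +
        (insProd ε (soDir i j) l x U).trace * prodW' ε (soDir i j) rest U) ∂(zdWilsonMeasure (soRep N) β' Λ) =
      (β' : ℂ) * ∫ U, (insProd ε (soDir i j) l x U).trace * prodW rest U *
        (actionDeriv' ε (soDir i j : Matrix (Fin N) (Fin N) ℂ) U : ℂ) ∂(zdWilsonMeasure (soRep N) β' Λ) := by
  haveI : IsProbabilityMeasure (zdWilsonMeasure (d := d) (soLatticeRep N).ρ β' Λ) :=
    isProbabilityMeasure_soWilson (d := d) (N := N) β' Λ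
  set X : Matrix (Fin N) (Fin N) ℂ := soDir i j with hXdef
  have hμ : IsHaarShiftStateAt (soLatticeRep N).ρ β' (zdWilsonMeasure (soLatticeRep N).ρ β' Λ) ε :=
    isHaarShiftStateAt_zdWilsonMeasure_rep (soLatticeRep N) β' Λ ε hl
  have hk := soFlow_add i j
  have hX : ∀ t, (soLatticeRep N).ρ (soFlow i j t) = exp ((t : ℂ) • X) := soRep_soFlow i j
  -- the test function and its derivative
  have hf' : ∀ U : LGConfig d (SO N), HasDerivAt
      (fun t : ℝ => (insProd ε X l x (Function.update U ε (soFlow i j t * U ε))).trace *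
        prodW rest (Function.update U ε (soFlow i j t * U ε)))
      ((∑ y : Fin l.length, (ins2Prod ε X l x y U).trace) * prodW rest U +
        (insProd ε X l x U).trace * prodW' ε X rest U) 0 := by
    intro U
    have h := (hasDerivAt_trace_insProd (ε := ε) hk hX U l x).mul (hasDerivAt_prodW ε X hk hX rest U)
    simp only [TiltedRP.update_shift_zero hk] at h
    exact h
  -- cylinder property
  have hfT : IsCylinder (fun U : LGConfig d (SO N) => (insProd ε X l x U).trace * prodW rest U)
      (support l ∪ supportSeq rest) := by
    intro U V h
    have e1 : insProd ε X l x U = insProd ε X l x V :=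
      dependsOn_insProd ε X l x (fun e he => h e (by rw [Finset.coe_union]; exact Set.mem_union_left _ he))
    have e2 : prodW rest U = prodW rest V :=
      dependsOn_prodW rest (fun e he => h e (by rw [Finset.coe_union]; exact Set.mem_union_right _ he))
    change (insProd ε X l x U).trace * prodW rest U = (insProd ε X l x V).trace * prodW rest V
    rw [e1, e2]
  have hf : Continuous fun U : LGConfig d (SO N) => (insProd ε X l x U).trace * prodW rest U :=
    (continuous_insProd ε X l x).matrix_trace.mul (continuous_prodW rest)
  have hf'c : Continuous fun U : LGConfig d (SO N) => (∑ y : Fin l.length, (ins2Prod ε X l x y U).trace) *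
      prodW rest U + (insProd ε X l x U).trace * prodW' ε X rest U :=
    ((continuous_finsetSum _ fun y _ => (continuous_ins2Prod ε X l x y).matrix_trace).mul
      (continuous_prodW rest)).add ((continuous_insProd ε X l x).matrix_trace.mul (continuous_prodW' ε X rest))
  have h := IsHaarShiftStateAt.integral_shiftDeriv_eq_complex (soLatticeRep N) hμ hk
    (fun U => (insProd ε X l x U).trace * prodW rest U)
    (fun U => (∑ y : Fin l.length, (ins2Prod ε X l x y U).trace) * prodW rest U +
      (insProd ε X l x U).trace * prodW' ε X rest U)
    hfT hf hf'c hf' (actionDeriv' ε X) continuous_actionDeriv'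
    (fun U => hasDerivAt_wilsonBoundaryAction' hk hX U)
  exact h

end Identity

end SOMasterLoop

end Summit.QuantumFields.GaugeBoot
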